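import Literature.Topology.FourManifolds.TautFoliationsContourSquareFloor
import HarnessLib

/-!
# Contour lines of the cone of a square near a corner

Topic: sequel to `TautFoliationsContourSquare.lean`, `TautFoliationsContourSquareFloor.lean`.
For the cone of the square `Q = closedBall c ℓ` (max norm) with apex height `m` over boundary
heights `ψ`, we describe the level set of the corner height `ψ v` near a **corner** `v` of
`Q` — the local structure of the singularities of the contour foliation of a disc in general
position at the grid vertices (Camacho–Lins Neto, Ch. VI §3–4: finitely many separatrices at
each singular point):

* `dist_proj_le` (**proved**): a point of the square within `δ ≤ ℓ / 2` of a boundary point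
  `v` projects radially to within `4δ` of `v`.
* `exists_eq_corner_add_smul` (**proved**): a boundary point within `ε ≤ ℓ` of the corner
  `v = c + (σ₁ ℓ, σ₂ ℓ)` lies on one of the two edges at `v`: it is `v + t • dᵢ`,
  `t ∈ [0, ε)`, with `d₁ = (-σ₁, 0)`, `d₂ = (0, -σ₂)`.
* `cornerArc` (**definition**): the level points `levelPt (v + t • dᵢ) (ψ v)` over an edge at
  the corner; `cornerArc_zero`, `continuousOn_cornerArc`, `coneHt_cornerArc`,
  `cornerArc_mem_closedBall`, `cornerArc_ne_center`, `cornerArc_ne_corner` (**proved**).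
* `eq_corner_or_exists_eq_cornerArc` (**proved**, roof apex): **near the corner, a point of the
  punctured square at the corner height is the corner or a point `cornerArc i t`, `0 < t`,
  over an edge at the corner along which the boundary height does not exceed the corner height
  at the parameter `t`**; with a *tame* boundary height (strictly monotone or constant on an
  initial piece of each edge) the admissible parameters form, for each edge, either no or a
  whole initial interval (`forall_le_or_forall_lt_of_tame`).

All statements are [folklore] (elementary real analysis).
-/

open Set Filter Metric Topology

namespace Literature.Topology.FourManifolds

namespace ConeSquare

variable {c v : ℝ × ℝ} {ℓ m : ℝ} {ψ : ℝ × ℝ → ℝ} {x q : ℝ × ℝ} {h t : ℝ}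

/-! ## Radial projection near the boundary -/

/-- **A point of the square within `δ ≤ ℓ / 2` of a boundary point `v` projects to within `4δ`
of `v`.** [folklore] -/
theorem dist_proj_le (hℓ : 0 < ℓ) (hv : v ∈ sphere c ℓ) (hx : x ∈ closedBall c ℓ) {δ : ℝ} (hδ : dist x v ≤ δ)
    (hδℓ : δ ≤ ℓ / 2) : dist (proj c ℓ x) v ≤ 4 * δ := by
  rw [mem_sphere] at hv
  rw [mem_closedBall] at hx
  have hδ₀ : 0 ≤ δ := dist_nonneg.trans hδ
  -- the distance `d` of `x` to the centre is within `δ` of `ℓ`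
  set d := dist x c with hd
  have hdl : ℓ - δ ≤ d := by
    have := dist_triangle v x c
    rw [dist_comm v x] at this
    linarith
  have hdpos : 0 < d := by linarith
  have hxc : x ≠ c := fun h ↦ by rw [h, dist_self] at hd; linarith
  rw [proj_of_ne hxc, dist_eq_norm]
  -- `proj x - v = (ℓ / d) • (x - v) + (ℓ / d - 1) • (v - c)`
  have hdecomp : c + (ℓ / d) • (x - c) - v = (ℓ / d) • (x - v) + (ℓ / d - 1) • (v - c) := by
    simp only [smul_sub, sub_smul, one_smul]
    abel
  rw [hdecomp]
  have h₁ : ‖(ℓ / d) • (x - v)‖ ≤ ℓ / d * δ := by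
    rw [norm_smul, Real.norm_eq_abs, abs_of_pos (div_pos hℓ hdpos), ← dist_eq_norm]
    exact mul_le_mul_of_nonneg_left hδ (div_pos hℓ hdpos).le
  have h₂ : ‖(ℓ / d - 1) • (v - c)‖ ≤ ℓ / d * δ := by
    rw [norm_smul, Real.norm_eq_abs, ← dist_eq_norm, hv]
    have hle : |ℓ / d - 1| ≤ δ / d := by
      rw [show ℓ / d - 1 = (ℓ - d) / d by field_simp, abs_div, abs_of_pos hdpos]
      exact div_le_div_of_nonneg_right (abs_le.2 ⟨by linarith, by linarith⟩) hdpos.le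
    calc |ℓ / d - 1| * ℓ ≤ δ / d * ℓ := mul_le_mul_of_nonneg_right hle hℓ.le
      _ = ℓ / d * δ := by ring
  have h₃ : ℓ / d * δ ≤ 2 * δ := by
    rw [div_mul_eq_mul_div, div_le_iff₀ hdpos]
    nlinarith
  calc ‖(ℓ / d) • (x - v) + (ℓ / d - 1) • (v - c)‖ ≤ ‖(ℓ / d) • (x - v)‖ + ‖(ℓ / d - 1) • (v - c)‖ := norm_add_le _ _
    _ ≤ 4 * δ := by linarith

/-! ## Boundary points near a corner lie on the two edges at the corner -/

/-- The direction of the first edge at the corner `c + (σ₁ ℓ, σ₂ ℓ)`. [folklore] -/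
def cornerDir₁ (σ₁ : ℝ) : ℝ × ℝ := (-σ₁, 0)

/-- The direction of the second edge at the corner `c + (σ₁ ℓ, σ₂ ℓ)`. [folklore] -/
def cornerDir₂ (σ₂ : ℝ) : ℝ × ℝ := (0, -σ₂)

/-- The direction of the `i`-th edge at the corner (`i : Bool`). [folklore] -/
def cornerDir (σ₁ σ₂ : ℝ) (i : Bool) : ℝ × ℝ := if i then cornerDir₁ σ₁ else cornerDir₂ σ₂

/-- The corner of signs `(σ₁, σ₂)`. [folklore] -/
def corner (c : ℝ × ℝ) (ℓ σ₁ σ₂ : ℝ) : ℝ × ℝ := (c.1 + σ₁ * ℓ, c.2 + σ₂ * ℓ)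

/-- A sign. [folklore] -/
def IsSign (σ : ℝ) : Prop := σ = 1 ∨ σ = -1

/-- The square of a sign is one. [folklore] -/
theorem IsSign.mul_self {σ : ℝ} (h : IsSign σ) : σ * σ = 1 := by
  rcases h with rfl | rfl <;> norm_num

/-- The absolute value of a sign is one. [folklore] -/
theorem IsSign.abs_eq {σ : ℝ} (h : IsSign σ) : |σ| = 1 := by
  rcases h with rfl | rfl <;> norm_num

/-- The corner is a boundary point. [folklore] -/
theorem corner_mem_sphere (hℓ : 0 < ℓ) {σ₁ σ₂ : ℝ} (h₁ : IsSign σ₁) (h₂ : IsSign σ₂) :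
    corner c ℓ σ₁ σ₂ ∈ sphere c ℓ := by
  rw [mem_sphere, Prod.dist_eq, corner, Real.dist_eq, Real.dist_eq]
  simp only [add_sub_cancel_left, abs_mul, h₁.abs_eq, h₂.abs_eq, one_mul, abs_of_pos hℓ, max_self]

/-- The points of the edges at the corner, `v + t • dᵢ`, `t ∈ [0, 2ℓ]`, are boundary points.
[folklore] -/
theorem corner_add_smul_mem_sphere (hℓ : 0 < ℓ) {σ₁ σ₂ : ℝ} (h₁ : IsSign σ₁) (h₂ : IsSign σ₂) (i : Bool)
    (ht : t ∈ Icc 0 (2 * ℓ)) : corner c ℓ σ₁ σ₂ + t • cornerDir σ₁ σ₂ i ∈ sphere c ℓ := by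
  rw [mem_sphere, Prod.dist_eq, Real.dist_eq, Real.dist_eq]
  cases i
  · -- second edge: first coordinate at distance `ℓ`, second within `ℓ`
    simp only [cornerDir, corner, cornerDir₂, Bool.false_eq_true, ↓reduceIte, Prod.fst_add, Prod.smul_fst,
      smul_eq_mul, mul_zero, add_zero, add_sub_cancel_left, Prod.snd_add, Prod.smul_snd]
    rw [abs_mul, h₁.abs_eq, one_mul, abs_of_pos hℓ]
    refine max_eq_left ?_
    rw [show c.2 + σ₂ * ℓ + t * -σ₂ - c.2 = σ₂ * (ℓ - t) by ring, abs_mul, h₂.abs_eq, one_mul]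
    exact abs_le.2 ⟨by linarith [ht.2], by linarith [ht.1]⟩
  · simp only [cornerDir, corner, cornerDir₁, ↓reduceIte, Prod.fst_add, Prod.smul_fst, smul_eq_mul, Prod.snd_add,
      Prod.smul_snd, mul_zero, add_zero, add_sub_cancel_left]
    rw [abs_mul, h₂.abs_eq, one_mul, abs_of_pos hℓ]
    refine max_eq_right ?_
    rw [show c.1 + σ₁ * ℓ + t * -σ₁ - c.1 = σ₁ * (ℓ - t) by ring, abs_mul, h₁.abs_eq, one_mul]
    exact abs_le.2 ⟨by linarith [ht.2], by linarith [ht.1]⟩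

/-- The distance from the corner along an edge. [folklore] -/
theorem dist_corner_add_smul {σ₁ σ₂ : ℝ} (h₁ : IsSign σ₁) (h₂ : IsSign σ₂) (i : Bool) (ht : 0 ≤ t) :
    dist (corner c ℓ σ₁ σ₂ + t • cornerDir σ₁ σ₂ i) (corner c ℓ σ₁ σ₂) = t := by
  rw [dist_eq_norm, add_sub_cancel_left, norm_smul, Real.norm_eq_abs, abs_of_nonneg ht, Prod.norm_def]
  cases i
  · simp [cornerDir, cornerDir₂, h₂.abs_eq]
  · simp [cornerDir, cornerDir₁, h₁.abs_eq]

/-- **A boundary point within `ε ≤ ℓ` of a corner lies on one of the two edges at the corner.**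
[folklore] -/
theorem exists_eq_corner_add_smul (hℓ : 0 < ℓ) {σ₁ σ₂ : ℝ} (h₁ : IsSign σ₁) (h₂ : IsSign σ₂)
    (hq : q ∈ sphere c ℓ) {ε : ℝ} (hε : ε ≤ ℓ) (hqv : dist q (corner c ℓ σ₁ σ₂) < ε) :
    ∃ (i : Bool) (t : ℝ), t ∈ Ico 0 ε ∧ q = corner c ℓ σ₁ σ₂ + t • cornerDir σ₁ σ₂ i := by
  rw [mem_sphere, Prod.dist_eq, Real.dist_eq, Real.dist_eq] at hq
  rw [Prod.dist_eq, corner, Real.dist_eq, Real.dist_eq, max_lt_iff] at hqv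
  have hq₁ : |q.1 - (c.1 + σ₁ * ℓ)| < ε := hqv.1
  have hq₂ : |q.2 - (c.2 + σ₂ * ℓ)| < ε := hqv.2
  have hσ₁ := h₁.mul_self
  have hσ₂ := h₂.mul_self
  have key₁ := abs_lt.1 (lt_of_lt_of_le hq₁ hε)
  have key₂ := abs_lt.1 (lt_of_lt_of_le hq₂ hε)
  -- which coordinate realises the maximum
  rcases le_total |q.1 - c.1| |q.2 - c.2| with hle | hle
  · -- `|q.2 - c.2| = ℓ`: on the first edge, `q.2 = c.2 + σ₂ ℓ`
    rw [max_eq_right hle] at hq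
    have hq₁le : |q.1 - c.1| ≤ ℓ := hle.trans hq.le
    have hq2 : q.2 = c.2 + σ₂ * ℓ := by
      rcases h₂ with rfl | rfl <;> rcases (abs_eq hℓ.le).1 hq with h | h <;> linarith [key₂.1, key₂.2]
    set t := σ₁ * (c.1 + σ₁ * ℓ - q.1) with ht
    have hte : t * -σ₁ = -(c.1 + σ₁ * ℓ - q.1) := by
      rw [ht, show σ₁ * (c.1 + σ₁ * ℓ - q.1) * -σ₁ = -(σ₁ * σ₁) * (c.1 + σ₁ * ℓ - q.1) by ring, hσ₁]
      ring
    refine ⟨true, t, ⟨?_, ?_⟩, ?_⟩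
    · have hb := abs_le.1 hq₁le
      rcases h₁ with rfl | rfl
      · rw [ht]; linarith [hb.2]
      · rw [ht]; linarith [hb.1]
    · calc t ≤ |t| := le_abs_self _
        _ = |q.1 - (c.1 + σ₁ * ℓ)| := by rw [ht, abs_mul, h₁.abs_eq, one_mul, abs_sub_comm]
        _ < ε := hq₁
    · ext
      · simp only [corner, cornerDir, cornerDir₁, ↓reduceIte, Prod.fst_add, Prod.smul_fst, smul_eq_mul]
        linarith [hte]
      · simp only [corner, cornerDir, cornerDir₁, ↓reduceIte, Prod.snd_add, Prod.smul_snd, smul_eq_mul, mul_zero,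
          add_zero]
        exact hq2
  · -- `|q.1 - c.1| = ℓ`: on the second edge, `q.1 = c.1 + σ₁ ℓ`
    rw [max_eq_left hle] at hq
    have hq₂le : |q.2 - c.2| ≤ ℓ := hle.trans hq.le
    have hq1 : q.1 = c.1 + σ₁ * ℓ := by
      rcases h₁ with rfl | rfl <;> rcases (abs_eq hℓ.le).1 hq with h | h <;> linarith [key₁.1, key₁.2]
    set t := σ₂ * (c.2 + σ₂ * ℓ - q.2) with ht
    have hte : t * -σ₂ = -(c.2 + σ₂ * ℓ - q.2) := by
      rw [ht, show σ₂ * (c.2 + σ₂ * ℓ - q.2) * -σ₂ = -(σ₂ * σ₂) * (c.2 + σ₂ * ℓ - q.2) by ring, hσ₂]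
      ring
    refine ⟨false, t, ⟨?_, ?_⟩, ?_⟩
    · have hb := abs_le.1 hq₂le
      rcases h₂ with rfl | rfl
      · rw [ht]; linarith [hb.2]
      · rw [ht]; linarith [hb.1]
    · calc t ≤ |t| := le_abs_self _
        _ = |q.2 - (c.2 + σ₂ * ℓ)| := by rw [ht, abs_mul, h₂.abs_eq, one_mul, abs_sub_comm]
        _ < ε := hq₂
    · ext
      · simp only [corner, cornerDir, cornerDir₂, Bool.false_eq_true, ↓reduceIte, Prod.fst_add, Prod.smul_fst,
          smul_eq_mul, mul_zero, add_zero]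
        exact hq1
      · simp only [corner, cornerDir, cornerDir₂, Bool.false_eq_true, ↓reduceIte, Prod.snd_add, Prod.smul_snd,
          smul_eq_mul]
        linarith [hte]

/-- The edge directions are nonzero. [folklore] -/
theorem cornerDir_ne_zero {σ₁ σ₂ : ℝ} (h₁ : IsSign σ₁) (h₂ : IsSign σ₂) (i : Bool) : cornerDir σ₁ σ₂ i ≠ 0 := by
  intro h
  cases i
  · have : (cornerDir σ₁ σ₂ false).2 = 0 := by rw [h]; rfl
    simp only [cornerDir, Bool.false_eq_true, ↓reduceIte, cornerDir₂, neg_eq_zero] at this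
    rcases h₂ with rfl | rfl <;> norm_num at this
  · have : (cornerDir σ₁ σ₂ true).1 = 0 := by rw [h]; rfl
    simp only [cornerDir, ↓reduceIte, cornerDir₁, neg_eq_zero] at this
    rcases h₁ with rfl | rfl <;> norm_num at this

/-! ## The level arcs over the edges at a corner (roof apex) -/

/-- **The corner arc**: the level points, at the corner height, over the `i`-th edge at the
corner of signs `(σ₁, σ₂)`. [folklore] -/
noncomputable def cornerArc (c : ℝ × ℝ) (ℓ m : ℝ) (ψ : ℝ × ℝ → ℝ) (σ₁ σ₂ : ℝ) (i : Bool) (t : ℝ) : ℝ × ℝ :=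
  levelPt c m ψ (corner c ℓ σ₁ σ₂ + t • cornerDir σ₁ σ₂ i) (ψ (corner c ℓ σ₁ σ₂))

section Roof

variable {σ₁ σ₂ : ℝ} (hℓ : 0 < ℓ) (hm : ∀ q ∈ sphere c ℓ, ψ q < m) (h₁ : IsSign σ₁) (h₂ : IsSign σ₂)
include hℓ hm h₁ h₂

/-- The corner arc starts at the corner. [folklore] -/
theorem cornerArc_zero (i : Bool) : cornerArc c ℓ m ψ σ₁ σ₂ i 0 = corner c ℓ σ₁ σ₂ := by
  have hv := corner_mem_sphere (c := c) hℓ h₁ h₂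
  have hψ : m - ψ (corner c ℓ σ₁ σ₂) ≠ 0 := by linarith [hm _ hv]
  simp only [cornerArc, zero_smul, add_zero, levelPt, div_self hψ, one_smul, add_sub_cancel]

/-- **The height along the corner arc is the corner height**, wherever the boundary height does
not exceed the corner height. [folklore] -/
theorem coneHt_cornerArc (i : Bool) (ht : t ∈ Icc 0 (2 * ℓ)) :
    coneHt c ℓ m ψ (cornerArc c ℓ m ψ σ₁ σ₂ i t) = ψ (corner c ℓ σ₁ σ₂) := by
  have hq := corner_add_smul_mem_sphere (c := c) hℓ h₁ h₂ i ht
  exact coneHt_levelPt hℓ hq (hm _ hq) (hm _ (corner_mem_sphere hℓ h₁ h₂)).le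

/-- The corner arc lies in the square where the boundary height does not exceed the corner
height. [folklore] -/
theorem cornerArc_mem_closedBall (i : Bool) (ht : t ∈ Icc 0 (2 * ℓ))
    (hψ : ψ (corner c ℓ σ₁ σ₂ + t • cornerDir σ₁ σ₂ i) ≤ ψ (corner c ℓ σ₁ σ₂)) :
    cornerArc c ℓ m ψ σ₁ σ₂ i t ∈ closedBall c ℓ := by
  have hq := corner_add_smul_mem_sphere (c := c) hℓ h₁ h₂ i ht
  exact (levelPt_mem_closedBall_iff hℓ hq (hm _ hq) (hm _ (corner_mem_sphere hℓ h₁ h₂)).le).2 hψ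

/-- The corner arc avoids the centre. [folklore] -/
theorem cornerArc_ne_center (i : Bool) (ht : t ∈ Icc 0 (2 * ℓ)) : cornerArc c ℓ m ψ σ₁ σ₂ i t ≠ c := by
  have hq := corner_add_smul_mem_sphere (c := c) hℓ h₁ h₂ i ht
  have hv := corner_mem_sphere (c := c) hℓ h₁ h₂
  rw [cornerArc, Ne, levelPt_eq_center_iff hℓ hq (hm _ hq) (hm _ hv).le]
  exact (hm _ hv).ne

/-- The corner arc projects to the edge point. [folklore] -/
theorem proj_cornerArc (i : Bool) (ht : t ∈ Icc 0 (2 * ℓ)) :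
    proj c ℓ (cornerArc c ℓ m ψ σ₁ σ₂ i t) = corner c ℓ σ₁ σ₂ + t • cornerDir σ₁ σ₂ i := by
  have hq := corner_add_smul_mem_sphere (c := c) hℓ h₁ h₂ i ht
  exact proj_levelPt hℓ hq (hm _ hq) (hm _ (corner_mem_sphere hℓ h₁ h₂))

/-- **The corner arc avoids the corner for positive parameters.** [folklore] -/
theorem cornerArc_ne_corner (i : Bool) (ht : t ∈ Ioc 0 (2 * ℓ)) : cornerArc c ℓ m ψ σ₁ σ₂ i t ≠ corner c ℓ σ₁ σ₂ := by
  intro h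
  have hp := proj_cornerArc (c := c) hℓ hm h₁ h₂ i ⟨ht.1.le, ht.2⟩
  rw [h, proj_of_mem_sphere hℓ (corner_mem_sphere hℓ h₁ h₂)] at hp
  have : t • cornerDir σ₁ σ₂ i = 0 := by
    have := congrArg (fun w ↦ w - corner c ℓ σ₁ σ₂) hp
    simpa using this.symm
  rcases smul_eq_zero.1 this with h0 | h0
  · exact ht.1.ne' h0
  · exact cornerDir_ne_zero h₁ h₂ i h0

/-- **The corner arc is continuous** on `[0, 2ℓ]` (for `ψ` continuous on the boundary).
[folklore] -/
theorem continuousOn_cornerArc (hψ : ContinuousOn ψ (sphere c ℓ)) (i : Bool) :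
    ContinuousOn (cornerArc c ℓ m ψ σ₁ σ₂ i) (Icc 0 (2 * ℓ)) := by
  have hedge : Continuous fun t : ℝ ↦ corner c ℓ σ₁ σ₂ + t • cornerDir σ₁ σ₂ i :=
    continuous_const.add (continuous_id.smul continuous_const)
  have h := (continuousOn_levelPt (c := c) hm hψ).comp
    (hedge.prodMk continuous_const : Continuous fun t : ℝ ↦ (corner c ℓ σ₁ σ₂ + t • cornerDir σ₁ σ₂ i,
      ψ (corner c ℓ σ₁ σ₂))).continuousOn
    (fun t ht ↦ ⟨corner_add_smul_mem_sphere hℓ h₁ h₂ i ht, mem_univ _⟩)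
  exact h

/-- The corner arc tends to the corner. [folklore] -/
theorem tendsto_cornerArc (hψ : ContinuousOn ψ (sphere c ℓ)) (i : Bool) :
    Tendsto (cornerArc c ℓ m ψ σ₁ σ₂ i) (𝓝[Icc 0 (2 * ℓ)] 0) (𝓝 (corner c ℓ σ₁ σ₂)) := by
  have h := (continuousOn_cornerArc (c := c) hℓ hm h₁ h₂ hψ i) 0 ⟨le_rfl, by linarith⟩
  rwa [ContinuousWithinAt, cornerArc_zero hℓ hm h₁ h₂] at h

/-- **Level points near a corner (roof apex).** A point of the punctured square within
`r ≤ ℓ / 8` of the corner, at the corner height, is the corner itself or the point of a corner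
arc with parameter `t ∈ (0, 4r)` over an edge point where the boundary height does not exceed the
corner height. [folklore] -/
theorem eq_corner_or_exists_eq_cornerArc (hx : x ∈ closedBall c ℓ) {r : ℝ} (hr : r ≤ ℓ / 8)
    (hxv : dist x (corner c ℓ σ₁ σ₂) < r) (hlev : coneHt c ℓ m ψ x = ψ (corner c ℓ σ₁ σ₂)) :
    x = corner c ℓ σ₁ σ₂ ∨ ∃ (i : Bool) (t : ℝ), t ∈ Ioo 0 (4 * r) ∧
      ψ (corner c ℓ σ₁ σ₂ + t • cornerDir σ₁ σ₂ i) ≤ ψ (corner c ℓ σ₁ σ₂) ∧ x = cornerArc c ℓ m ψ σ₁ σ₂ i t := by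
  have hv := corner_mem_sphere (c := c) hℓ h₁ h₂
  set q := proj c ℓ x with hq
  have hqs : q ∈ sphere c ℓ := proj_mem_sphere hℓ x
  have hxq : x = levelPt c m ψ q (ψ (corner c ℓ σ₁ σ₂)) := eq_levelPt_of_coneHt_eq hℓ hm hlev
  have hψq : ψ q ≤ ψ (corner c ℓ σ₁ σ₂) := by rw [← hlev]; exact le_coneHt hℓ hm hx
  have hr₀ : 0 < r := lt_of_le_of_lt dist_nonneg hxv
  have hqv : dist q (corner c ℓ σ₁ σ₂) < 4 * r := by
    have h := dist_proj_le hℓ hv hx le_rfl (by linarith [dist_nonneg (x := x) (y := corner c ℓ σ₁ σ₂)])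
    linarith
  obtain ⟨i, t, ht, hqt⟩ := exists_eq_corner_add_smul hℓ h₁ h₂ hqs (by linarith) hqv
  rcases ht.1.eq_or_lt with h0 | h0
  · left
    rw [hxq, hqt, ← h0]
    exact cornerArc_zero hℓ hm h₁ h₂ i
  · right
    refine ⟨i, t, ⟨h0, ht.2⟩, by rw [← hqt]; exact hψq, ?_⟩
    rw [hxq, hqt]
    rfl

end Roof

/-! ## Floor apex: the mirrored statements -/

/-- Negating the data does not change the corner arcs. [folklore] -/
theorem cornerArc_neg (c : ℝ × ℝ) (ℓ m : ℝ) (ψ : ℝ × ℝ → ℝ) (σ₁ σ₂ : ℝ) (i : Bool) (t : ℝ) :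
    cornerArc c ℓ (-m) (fun y ↦ -ψ y) σ₁ σ₂ i t = cornerArc c ℓ m ψ σ₁ σ₂ i t := by
  rw [cornerArc, cornerArc, ← levelPt_neg c m ψ]

/-- A floor apex is a roof apex for the negated data. [folklore] -/
theorem neg_roof (hm : ∀ q ∈ sphere c ℓ, m < ψ q) : ∀ q ∈ sphere c ℓ, (fun y ↦ -ψ y) q < -m := fun q hq ↦ by
  have := hm q hq; dsimp only; linarith

section Floor

variable {σ₁ σ₂ : ℝ} (hℓ : 0 < ℓ) (hm : ∀ q ∈ sphere c ℓ, m < ψ q) (h₁ : IsSign σ₁) (h₂ : IsSign σ₂)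
include hℓ hm h₁ h₂

/-- The corner arc starts at the corner (floor apex). [folklore] -/
theorem cornerArc_zero_floor (i : Bool) : cornerArc c ℓ m ψ σ₁ σ₂ i 0 = corner c ℓ σ₁ σ₂ := by
  rw [← cornerArc_neg]; exact cornerArc_zero hℓ (neg_roof hm) h₁ h₂ i

/-- The height along the corner arc is the corner height (floor apex). [folklore] -/
theorem coneHt_cornerArc_floor (i : Bool) (ht : t ∈ Icc 0 (2 * ℓ)) :
    coneHt c ℓ m ψ (cornerArc c ℓ m ψ σ₁ σ₂ i t) = ψ (corner c ℓ σ₁ σ₂) := by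
  have h := coneHt_cornerArc (c := c) (t := t) hℓ (neg_roof hm) h₁ h₂ i ht
  rw [cornerArc_neg, coneHt_neg] at h
  simp only [neg_inj] at h
  exact h

/-- The corner arc lies in the square where the boundary height is at least the corner height
(floor apex). [folklore] -/
theorem cornerArc_mem_closedBall_floor (i : Bool) (ht : t ∈ Icc 0 (2 * ℓ))
    (hψ : ψ (corner c ℓ σ₁ σ₂) ≤ ψ (corner c ℓ σ₁ σ₂ + t • cornerDir σ₁ σ₂ i)) :
    cornerArc c ℓ m ψ σ₁ σ₂ i t ∈ closedBall c ℓ := by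
  rw [← cornerArc_neg]
  exact cornerArc_mem_closedBall hℓ (neg_roof hm) h₁ h₂ i ht (by linarith)

/-- The corner arc avoids the centre (floor apex). [folklore] -/
theorem cornerArc_ne_center_floor (i : Bool) (ht : t ∈ Icc 0 (2 * ℓ)) : cornerArc c ℓ m ψ σ₁ σ₂ i t ≠ c := by
  rw [← cornerArc_neg]; exact cornerArc_ne_center hℓ (neg_roof hm) h₁ h₂ i ht

/-- The corner arc avoids the corner for positive parameters (floor apex). [folklore] -/
theorem cornerArc_ne_corner_floor (i : Bool) (ht : t ∈ Ioc 0 (2 * ℓ)) :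
    cornerArc c ℓ m ψ σ₁ σ₂ i t ≠ corner c ℓ σ₁ σ₂ := by
  rw [← cornerArc_neg]; exact cornerArc_ne_corner hℓ (neg_roof hm) h₁ h₂ i ht

/-- The corner arc is continuous (floor apex). [folklore] -/
theorem continuousOn_cornerArc_floor (hψ : ContinuousOn ψ (sphere c ℓ)) (i : Bool) :
    ContinuousOn (cornerArc c ℓ m ψ σ₁ σ₂ i) (Icc 0 (2 * ℓ)) := by
  have h := continuousOn_cornerArc (c := c) hℓ (neg_roof hm) h₁ h₂ (hψ.neg) i
  refine h.congr fun t _ ↦ ?_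
  rw [cornerArc_neg]

/-- **Level points near a corner (floor apex).** [folklore] -/
theorem eq_corner_or_exists_eq_cornerArc_floor (hx : x ∈ closedBall c ℓ) {r : ℝ} (hr : r ≤ ℓ / 8)
    (hxv : dist x (corner c ℓ σ₁ σ₂) < r) (hlev : coneHt c ℓ m ψ x = ψ (corner c ℓ σ₁ σ₂)) :
    x = corner c ℓ σ₁ σ₂ ∨ ∃ (i : Bool) (t : ℝ), t ∈ Ioo 0 (4 * r) ∧
      ψ (corner c ℓ σ₁ σ₂) ≤ ψ (corner c ℓ σ₁ σ₂ + t • cornerDir σ₁ σ₂ i) ∧ x = cornerArc c ℓ m ψ σ₁ σ₂ i t := by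
  have h := eq_corner_or_exists_eq_cornerArc (c := c) (x := x) hℓ (neg_roof hm) h₁ h₂ hx hr hxv
    (by rw [coneHt_neg, hlev])
  rcases h with h | ⟨i, t, ht, hψ, hxt⟩
  · exact Or.inl h
  · refine Or.inr ⟨i, t, ht, by linarith, ?_⟩
    rw [hxt, cornerArc_neg]

end Floor

/-! ## The tame dichotomy along an edge -/

/-- For a function strictly monotone or constant on `[0, δ]` (tameness on the right at `0`),
either all its values on `(0, δ]` are at most the value at `0`, or all exceed it. [folklore] -/
theorem forall_le_or_forall_lt_of_tame {φ : ℝ → ℝ} {δ : ℝ}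
    (h : StrictMonoOn φ (Icc 0 δ) ∨ StrictAntiOn φ (Icc 0 δ) ∨ ∀ t ∈ Icc 0 δ, φ t = φ 0) :
    (∀ t ∈ Ioc 0 δ, φ t ≤ φ 0) ∨ ∀ t ∈ Ioc 0 δ, φ 0 < φ t := by
  rcases h with h | h | h
  · exact Or.inr fun t ht ↦ h ⟨le_rfl, ht.1.le.trans ht.2⟩ ⟨ht.1.le, ht.2⟩ ht.1
  · exact Or.inl fun t ht ↦ (h ⟨le_rfl, ht.1.le.trans ht.2⟩ ⟨ht.1.le, ht.2⟩ ht.1).le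
  · exact Or.inl fun t ht ↦ (h t ⟨ht.1.le, ht.2⟩).le

/-- The mirrored dichotomy: all values on `(0, δ]` at least the value at `0`, or all below it.
[folklore] -/
theorem forall_ge_or_forall_gt_of_tame {φ : ℝ → ℝ} {δ : ℝ}
    (h : StrictMonoOn φ (Icc 0 δ) ∨ StrictAntiOn φ (Icc 0 δ) ∨ ∀ t ∈ Icc 0 δ, φ t = φ 0) :
    (∀ t ∈ Ioc 0 δ, φ 0 ≤ φ t) ∨ ∀ t ∈ Ioc 0 δ, φ t < φ 0 := by
  rcases h with h | h | h
  · exact Or.inl fun t ht ↦ (h ⟨le_rfl, ht.1.le.trans ht.2⟩ ⟨ht.1.le, ht.2⟩ ht.1).le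
  · exact Or.inr fun t ht ↦ h ⟨le_rfl, ht.1.le.trans ht.2⟩ ⟨ht.1.le, ht.2⟩ ht.1
  · exact Or.inl fun t ht ↦ (h t ⟨ht.1.le, ht.2⟩).ge

end ConeSquare

end Literature.Topology.FourManifolds
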